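import Mathlib
import Summits.ResolutionOfSingularities.ResolutionOfSingularities.Theses.SyzygyFlattening
import Summits.ResolutionOfSingularities.ResolutionOfSingularities.Theorems.SyzygyFlatteningDefs
import Summits.ResolutionOfSingularities.ResolutionOfSingularities.Theorems.SyzygyFlatteningHigherRankTerminationRankLeOneDimZero
import Summits.ResolutionOfSingularities.ResolutionOfSingularities.Theorems.SyzygyFlatteningHigherRankTerminationTowerLocalisation
import Literature.AlgebraicGeometry.Resolution.CompositeValuations
import HarnessLib

/-!
# `HigherRankTermination` — the repaired cut (crux stmt-ResolutionOfSingularities-17045, lead c1)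

Route `ResolutionOfSingularities/SyzygyFlattening`, crux #3 `HigherRankTermination`
(`∀ p prime, RankOneInput p → DimZeroTermination p`).  The hypothesis `RankOneInput p` is crux #2
`RankOneTermination` at `p` VERBATIM, i.e. termination along rank-one valuation rings that are ALSO
of dimension zero.  Route-review objection O1 (REVIEW-SyzygyFlattening.md), the refuter's attack note and
lead -0's kernel-checked reduction `stub_cruxReduction` agree that, as typed, the crux silently contains
"rank-one termination in POSITIVE dimension at the ambient index" (`stub_posDimRankOne`), which the
route's own text assigns to crux #2 ("quantified over all fields k, so by `k ↦ k(t) ⊂ O_v` it covers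
rank-one valuations of every dimension" — false for the formal statement: the base change replaces the
syzygy index `n = tr.deg_k K` by `n − dim v` and the model `A` by `A·k(t)`, a different tower).

This file certifies the REPAIR proposed to the planner.  Write `AllRankOne p` for crux #2 at `p` with
its dimension-zero binder deleted (termination along EVERY rank-one valuation ring `O ⊇ A ⊇ k`,
`ringKrullDim O = 1`), and `HR'` for `∀ p prime, AllRankOne p → DimZeroTermination p`.  Then,
kernel-checked and def-free (the statements are spelled out in the binders):

* `rankOneInput_of_allRankOne` — `AllRankOne p → RankOneInput p` (weakening);
* `stub_repairWeaker` — `HigherRankTermination → HR'`: the repaired crux is WEAKER than the filed one;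
* `stub_repairReduction` — `HR' ↔ ∀ p prime, AllRankOne p → residualSteering p`, where
  `residualSteering p` is the statement of the line's registered stub `stub_residualSteering`
  (for dimension-zero `O` and a proper coarsening `O < O₁ < K`, eventual persistent regularity of the
  `O`-tower at the centre of `O₁` implies termination along `O`).  So after the repair the crux IS
  residual steering — objection O1 disappears into the hypothesis, where the route wanted it;
* `closes_repaired` — the route's deciding chain with both cruxes repaired still closes the summit:
  `(∀ p prime, AllRankOne p) → HR' → Globalisation → ResolutionOfSingularities`.

Ingredients (all landed): `stub_rankLeOneDimZero` (two-overring case), `rankLeOne_ringKrullDim_eq_one`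
(the rank-one coarsening has Krull dimension one), `eventuallyRegularAlong_of_towerTerminates`
(the operator commutes with coarsening; regular stages are terminal), `finite_overrings_of_fg`
(a dimension-zero valuation ring over a finitely generated model has finitely many overrings, so a
largest proper one exists).

References: Novacoski–Spivakovsky, "Reduction of local uniformization to the rank one case"
(Valuation theory in interaction, 2014), Thm. 1.1 — the shape of the induction on the rank;
Zariski–Samuel II, Ch. VI §10 — composite valuations and their rank-one coarsenings.
-/

noncomputable section

-- single-problem summit: the doubled namespace component `ResolutionOfSingularities` is forced
set_option linter.dupNamespace false

open Literature.AlgebraicGeometry.Resolution (finite_overrings_of_fg)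
open Summit.ResolutionOfSingularities.ResolutionOfSingularities.Theses.SyzygyFlattening
  (HigherRankTermination Globalisation)

namespace Summit.ResolutionOfSingularities.ResolutionOfSingularities.Theorems.SyzygyFlattening

/-- **Weakening**: rank-one termination for ALL rank-one valuation rings at `p` implies the route's
`RankOneInput p` (rank one AND dimension zero) — forget the dimension-zero hypothesis. [folklore] -/
theorem rankOneInput_of_allRankOne (p : ℕ)
    (hR1' : ∀ (k K : Type) [Field k] [CharP k p] [Field K] [Algebra k K] (O : ValuationSubring K)
      (A : Subalgebra k K), (∀ c : k, algebraMap k K c ∈ O) → A.FG → IsFractionRing ↥A K →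
      A.toSubring ≤ O.toSubring → ringKrullDim ↥O = 1 → TowerTerminates O A) :
    RankOneInput p :=
  fun k K _ _ _ _ O A hk hFG hFrac hAO _ hrk => hR1' k K O A hk hFG hFrac hAO hrk

/-- **Registered glue stub `stub_repairWeaker` (crux stmt-ResolutionOfSingularities-17045): the
repaired crux is weaker than the filed one.**  `HigherRankTermination` implies
`HR' = ∀ p prime, AllRankOne p → DimZeroTermination p`, because `AllRankOne p → RankOneInput p`.
[folklore] -/
theorem stub_repairWeaker : HigherRankTermination →
    ∀ p : ℕ, p.Prime →
      (∀ (k K : Type) [Field k] [CharP k p] [Field K] [Algebra k K] (O : ValuationSubring K)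
        (A : Subalgebra k K), (∀ c : k, algebraMap k K c ∈ O) → A.FG → IsFractionRing ↥A K →
        A.toSubring ≤ O.toSubring → ringKrullDim ↥O = 1 → TowerTerminates O A) →
      ∀ (k K : Type) [Field k] [CharP k p] [Field K] [Algebra k K] (O : ValuationSubring K)
        (A : Subalgebra k K), (∀ c : k, algebraMap k K c ∈ O) → A.FG → IsFractionRing ↥A K →
        A.toSubring ≤ O.toSubring → DimZero k O → TowerTerminates O A :=
  fun hHR p hp hR1' k K _ _ _ _ O A hk hFG hFrac hAO halg =>
    (higherRankTermination_iff.mp hHR) p hp (rankOneInput_of_allRankOne p hR1') k K O A hk hFG hFrac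
      hAO halg

/-- **Registered glue stub `stub_repairReduction` (crux stmt-ResolutionOfSingularities-17045): after
the repair the crux IS residual steering.**  With `AllRankOne p` (crux #2 at `p` without its
dimension-zero binder) as hypothesis, termination along every dimension-zero valuation ring is
EQUIVALENT to residual steering (the statement of the line's stub `stub_residualSteering`).
(→) weakening.  (←) For dimension-zero `O ⊇ A ⊇ k`: if `O` has at most the two overrings `O, K`,
the landed `stub_rankLeOneDimZero` applies (through `rankOneInput_of_allRankOne`); otherwise the
largest proper overring `O₁` (finitely many: `finite_overrings_of_fg`) has exactly the overrings
`O₁, K`, hence `ringKrullDim O₁ = 1` (`rankLeOne_ringKrullDim_eq_one`), so `AllRankOne p` gives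
termination along `O₁` — no dimension hypothesis is asked any more — which the landed
`eventuallyRegularAlong_of_towerTerminates` transports to eventual regularity of the `O`-tower at
the centre of `O₁`; residual steering finishes.
[cite: NovacoskiSpivakovsky2014, Thm. 1.1 (shape of the induction on the rank)] -/
theorem stub_repairReduction :
    (∀ p : ℕ, p.Prime →
      (∀ (k K : Type) [Field k] [CharP k p] [Field K] [Algebra k K] (O : ValuationSubring K)
        (A : Subalgebra k K), (∀ c : k, algebraMap k K c ∈ O) → A.FG → IsFractionRing ↥A K →
        A.toSubring ≤ O.toSubring → ringKrullDim ↥O = 1 → TowerTerminates O A) →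
      ∀ (k K : Type) [Field k] [CharP k p] [Field K] [Algebra k K] (O : ValuationSubring K)
        (A : Subalgebra k K), (∀ c : k, algebraMap k K c ∈ O) → A.FG → IsFractionRing ↥A K →
        A.toSubring ≤ O.toSubring → DimZero k O → TowerTerminates O A) ↔
    (∀ p : ℕ, p.Prime →
      (∀ (k K : Type) [Field k] [CharP k p] [Field K] [Algebra k K] (O : ValuationSubring K)
        (A : Subalgebra k K), (∀ c : k, algebraMap k K c ∈ O) → A.FG → IsFractionRing ↥A K →
        A.toSubring ≤ O.toSubring → ringKrullDim ↥O = 1 → TowerTerminates O A) →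
      ∀ (k K : Type) [Field k] [CharP k p] [Field K] [Algebra k K] (O : ValuationSubring K)
        (A : Subalgebra k K), (∀ c : k, algebraMap k K c ∈ O) → A.FG → IsFractionRing ↥A K →
        A.toSubring ≤ O.toSubring → DimZero k O →
        ∀ O₁ : ValuationSubring K, O < O₁ → O₁ ≠ ⊤ → EventuallyRegularAlong O A O₁ →
        TowerTerminates O A) := by
  constructor
  · intro h p hp hR1' k K _ _ _ _ O A hk hFG hFrac hAO halg _ _ _ _
    exact h p hp hR1' k K O A hk hFG hFrac hAO halg
  · intro h p hp hR1' k K _ _ _ _ O A hk hFG hFrac hAO halg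
    have hRS := h p hp hR1'
    have hR1 : RankOneInput p := rankOneInput_of_allRankOne p hR1'
    -- two-overring case (trivial valuation or rank one): the landed base stub
    by_cases h2 : TwoOverrings O
    · exact stub_rankLeOneDimZero p hp hR1 k K O A hk hFG hFrac hAO halg h2
    -- otherwise pick the largest proper overring `O₁` of `O` (finitely many overrings)
    haveI : IsFractionRing ↥A K := hFrac
    have hfin : Finite {S : ValuationSubring K // O ≤ S} := finite_overrings_of_fg O hk A hFG
    have hTfin : ({S : ValuationSubring K | O ≤ S ∧ S ≠ ⊤} : Set (ValuationSubring K)).Finite := by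
      have h1 : ({S : ValuationSubring K | O ≤ S} : Set (ValuationSubring K)).Finite :=
        Set.finite_coe_iff.mp hfin
      exact h1.subset fun S hS => hS.1
    have hOtop : O ≠ ⊤ := by
      intro hO
      apply h2
      intro S hS
      exact Or.inr (top_le_iff.mp (hO ▸ hS))
    have hTne : ({S : ValuationSubring K | O ≤ S ∧ S ≠ ⊤} : Set (ValuationSubring K)).Nonempty :=
      ⟨O, le_rfl, hOtop⟩
    obtain ⟨O₁, hO₁⟩ := hTfin.exists_maximal hTne
    have hOO₁ : O ≤ O₁ := hO₁.1.1
    have hO₁top : O₁ ≠ ⊤ := hO₁.1.2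
    -- `O₁` has exactly the two overrings `O₁` and `K`, hence Krull dimension one
    have h2' : TwoOverrings O₁ := by
      intro S hS
      by_cases hSt : S = ⊤
      · exact Or.inr hSt
      · exact Or.inl (le_antisymm (hO₁.2 ⟨hOO₁.trans hS, hSt⟩ hS) hS)
    have hne : O ≠ O₁ := by
      intro hOeq
      apply h2
      intro S hS
      rcases h2' S (hOeq ▸ hS) with h | h
      · exact Or.inl (h.trans hOeq.symm)
      · exact Or.inr h
    have hlt : O < O₁ := lt_of_le_of_ne hOO₁ hne
    have hrk₁ : ringKrullDim ↥O₁ = 1 := rankLeOne_ringKrullDim_eq_one O₁ hO₁top h2'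
    -- termination along the rank-one coarsening: the REPAIRED hypothesis applies directly
    have hk₁ : ∀ c : k, algebraMap k K c ∈ O₁ := fun c => hOO₁ (hk c)
    have hAO₁ : A.toSubring ≤ O₁.toSubring := fun x hx => hOO₁ (hAO hx)
    have hterm₁ : TowerTerminates O₁ A := hR1' k K O₁ A hk₁ hFG hFrac hAO₁ hrk₁
    have hev : EventuallyRegularAlong O A O₁ :=
      eventuallyRegularAlong_of_towerTerminates O A hk hFG hFrac hAO O₁ hOO₁ hterm₁
    exact hRS k K O A hk hFG hFrac hAO halg O₁ hlt hO₁top hev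

/-- **The repaired deciding chain still closes the summit**: crux #2 without its dimension-zero
binder, the repaired crux #3, and `Globalisation` (unchanged) give `ResolutionOfSingularities` by the
same one-line composition as the route's `closes`. [folklore] -/
theorem closes_repaired
    (h1 : ∀ p : ℕ, p.Prime →
      ∀ (k K : Type) [Field k] [CharP k p] [Field K] [Algebra k K] (O : ValuationSubring K)
        (A : Subalgebra k K), (∀ c : k, algebraMap k K c ∈ O) → A.FG → IsFractionRing ↥A K →
        A.toSubring ≤ O.toSubring → ringKrullDim ↥O = 1 → TowerTerminates O A)
    (h2 : ∀ p : ℕ, p.Prime →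
      (∀ (k K : Type) [Field k] [CharP k p] [Field K] [Algebra k K] (O : ValuationSubring K)
        (A : Subalgebra k K), (∀ c : k, algebraMap k K c ∈ O) → A.FG → IsFractionRing ↥A K →
        A.toSubring ≤ O.toSubring → ringKrullDim ↥O = 1 → TowerTerminates O A) →
      ∀ (k K : Type) [Field k] [CharP k p] [Field K] [Algebra k K] (O : ValuationSubring K)
        (A : Subalgebra k K), (∀ c : k, algebraMap k K c ∈ O) → A.FG → IsFractionRing ↥A K →
        A.toSubring ≤ O.toSubring → DimZero k O → TowerTerminates O A)
    (hG : Globalisation) : _root_.ResolutionOfSingularities :=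
  fun p hp => (globalisation_iff.mp hG) p hp (h2 p hp (h1 p hp))

end Summit.ResolutionOfSingularities.ResolutionOfSingularities.Theorems.SyzygyFlattening

end
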